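import Literature.MathematicalPhysics.QuantumFieldTheory.Balaban1983to89.B8Prop6DentedCubeMemberNormsGammaRec
import Literature.MathematicalPhysics.QuantumFieldTheory.Balaban1983to89.B8Prop6DentedCubeMemberGammaPrecompRec

/-!
# `Balaban1983to89.B8Prop6DentedCubeMemberNormsGammaPrecompRec` — (1.42)₂ OF [Balaban1985RegularSpaces] AT ALL LEVELS ON PRINT's SPLIT CLASS AT THE DENTED RECORD MEMBER FOR THE
# PRE-COMPOSED THEOREM-4 INPUT `(U₀″)^{h}` (`h` unitary, constant on the block towers under the dented cells, oscillation `ω`): the pre-composed twin of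
# ✓`B8Prop6DentedCubeMemberNormsGammaRec.c137_dentedMember_γ` — the bookkeeping input of the crown's norm step, item (B′-4)·4 of the plan's road (B′) (pen dag-n05-e g42)

statement-level skeleton of published theorems with citation tags; proofs where landed; nothing here is a claim about the Yang–Mills mass gap

T. Bałaban, *Spaces of regular gauge field configurations on a lattice and gauge fixing conditions*, Commun. Math. Phys. **99** (1985) 75–102 `[Balaban1985RegularSpaces]`
("[6]"): (1.42) p. 83, (1.37) p. 82, (1.31) p. 82, (1.35) p. 82, (1.133) p. 99, p. 77; T. Bałaban, *The variational problem and background fields in renormalization group method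
for lattice gauge theories*, CMP **102** (1985) 277–309 `[Balaban1985Variational]` ("[15]"): (148)–(152) p. 301; T. Bałaban, *Propagators and renormalization transformations
for lattice gauge theories. II*, CMP **96** (1984) 223–250 `[Balaban1984PropagatorsII]` ("[B6]"): (2.3) p. 224; [I] = T. Bałaban, *Renormalization group approach to lattice
gauge field theories. I*, CMP **109** (1987) 249–301 `[Balaban1987RG1]`: (0.3)–(0.4), (0.6) pp. 252–253.  STATUS: published, refereed.

CITATION HEADER (lean-in-tree rule).  Cell `pub-ymgap` (HUMAN RULING D-0062, Track A), «N05-REC» road, ROAD (B′) = director-ym №310–№312a branch (ii) case (β); LEAD PEN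
dag-n05-e g42.  WHAT IS REPRODUCED: ★ `c137_dentedMember_precomposed_γ` — ✓`c137_dentedMember_γ` VERBATIM except the datum `U₀″ ↦ (U₀″)^{h}` (binders `h`, `X`, `hconst`,
`ω ≥ 0`, `hoscj`, `hosc0` of (B′-4)·2 ✓`B8Prop6DentedCubeMemberGammaPrecompRec.thm4_hypotheses_one_precomposed_dented_γ`, which supplies the §1 package) and `6dL²Mα₀ ↦
6dL²Mα₀ + ω` in the smallness and the conclusion; the margins ∕ windows lemmas of the original (`prop3_windowsZ`, `margin2_cubeFamZ`, `cubeLamZ_subset_lamS`,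
`mem_lamS_zero_of_not_mem_cube_one`) are datum-free and reused BY NAME downstream.  Consumer: F4 `…NormsFlatGammaPrecompRec`.  Kind «kernel-checked proof», ONE theorem; no
`def`, no `instance`, no `notation`, no existing module modified.  `--kind proof --supports stmt-QuantumFields-20541` (K0⁷-keyed, COUNT-NEUTRAL).

HONEST SCOPE.  Bookkeeping over the record's `H42_of_inAx_γ`; NO new estimate; `HThm4Rec*` CONDITIONAL; N05 DISCHARGED OF RECORD since R467 (count-neutral record-level work),
N07 NOT discharged; counts unmoved (typed 28∕28 · discharged 8∕28); one finite 𝕋⁴ programme at fixed ε, `G = SU(2)` of record — nothing continuum ∕ ℝ⁴ ∕ OS ∕ mass gap ∕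
Clay.  No `sorry`, no `def`.
-/

noncomputable section

open NormedSpace

namespace Literature.MathematicalPhysics.QuantumFieldTheory.Balaban1983to89.B8Prop6DentedCubeMemberNormsGammaPrecompRec

open MatrixLog B7Prop1Explicit B7Prop2Explicit B7Prop1Local
open B7Eq92Concrete (mgauge mgauge_one_left)
open B7Prop2Explicit (c2' c2'_pos unitaryUnits)
open B7Prop2Rec (AvgClosedZ C0Z C0Z_pos)
open B7Prop3Flat (c3 c3_pos)
open B7Prop4GeneralLevelsRec (cZ gZ KZ gZ_nonneg)
open BlockAveragingZd (avgIterZ ctrShift)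
open B7SectEFLinearisationRec (logCovIterZ)
open B8Ineq130Rec (tlo thi)
open B8Ineq130 (gaugeAct_one)
open B8Ineq132 (InAk)
open B8Ineq133Rec (cutFixedZ)
open B8Eq115GaugeFixing (gaugeAct_mul gaugeAct_mem_of)
open B8Eq119TwistedAxialRec (InAxZ Restr129Z)
open B8Eq146AExpansion (iEta)
open B8Eq184Proof (cfgExp)
open B8Eq140Level (SideTouches)
open B8Eq138LandauZd (logCfg)
open B8Eq131Cubes (tLo tHi ctr gs margin_succ margin_anti)
open B8Eq131CubesRec (bLoZ bHiZ sqLoZ sqHiZ inLoZ inHiZ cubeZ cube_eq inner_eq_blowup)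
open B8Eq131CubesAdmissibleRec (cubeFamZ cubeFam_false_of_le cubeFam_false_zero cubeFam_of_lt)
open B8CubeMemberZdRec (cubeLamZ)
open B8LeafModelZd3 (mlogCfg mlogCfg_spec)
open B8Thm4Windows (mul_le_one_of_le_inv exp_le_of_small)
open B9SupplySockB9P3ZdLettersOmega (Margin2)
open B8Eq142KLevelLocalGammaRec (H42_of_inAx_γ)
open B8DentedCubeMemberZdRec (lamST_top_apply hΩ_sq lamBPT_hbox_pred lamBPT_hclass)
open Node00 (CubeB8DZ)
open B7AvgGaugeCovariance (uLev)
open B8Eq119TwistedAxialRec (UnderZ)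
open B8Prop6DentedCubeMemberGammaPrecompRec (thm4_hypotheses_one_precomposed_dented_γ)

export B7Prop1Explicit (Site)

variable {d : ℕ}

/-! ## §1 (1.42)₂ at all levels on print's split class at the dented RECORD member, background `1`, datum `(U₀″)^h` -/

section KLevel

variable {𝔸 : Type*} [CStarAlgebra 𝔸] [Nontrivial 𝔸]

/-- ★ (PRE-COMPOSED twin of ✓`B8Prop6DentedCubeMemberNormsGammaRec.c137_dentedMember_γ`.) **(1.42)₂ AT ALL LEVELS FOR `U₁ = ((U₀″)^{h})^{u⁻¹}` AT BACKGROUND `1`, ON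
EVERY BOND OF THE SPLIT PRINT CLASS `c.lamBPT c.k j` OF THE DENTED RECORD MEMBER** — `H42_of_inAx_γ` (record) at the datum `(1, (U₀″)^h)`: `h` unitary, CONSTANT `= X(j, y)` on
the block tower under every dented cell `y ∈ Λ′_j` (`1 ≤ j ≤ k`), oscillation `≤ ω` across the (1.35) bonds and the level-0 collar (unitarity, (1.33), (1.34) = (1.132), `Ax` at
every truncation, and (1.66) = (1.133) in PRINT's guard with `6dL²Mα₀ + ω`, by (B′-4)·2 `thm4_hypotheses_one_precomposed_dented_γ`), class laws `lamBPT_hbox_pred` ∕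
`lamBPT_hclass`, (1.29) w.r.t. the dented record cells for `u`, the exponent `A = mlogCfg` of the (1.62)-data; the record's Prop-4 windows ONE LEVEL LOWER; smallness
`dL·(6dL²Mα₀ + ω) ≤ 1∕8`.  CONCLUSION: `‖Q_j(1, iηA)(b)‖ < 2dL·(6dL²Mα₀ + ω)` for every `j ≤ k`, `b ∈ c.lamBPT c.k j`, record averages.  Proof = the original's, datum token
substituted (item (B′-4)·4 of the plan's road (B′); director-ym №310 licence: variant, our proof).
[cite: Balaban1985RegularSpaces, (1.42) p.83, (1.37) p.82, (1.31) p.82, (1.35) p.82, (1.133) p.99, p.77; Balaban1985Variational, (148)–(152) p.301; Balaban1984PropagatorsII, (2.3) p.224; Balaban1987RG1, (0.3)–(0.4) pp.252–253, (0.6) p.253] -/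
theorem c137_dentedMember_precomposed_γ (hd2 : 2 ≤ d) {L s : ℕ} (hLs : L = 2 * s + 1) (hs : 1 ≤ s) {K : ℕ} {Ω : ℕ → Set (Site d)} (c : CubeB8DZ d L K Ω)
    (U₀ : Site d → Fin d → 𝔸ˣ) (hU₀ : ∀ x κ, U₀ x κ ∈ unitaryUnits 𝔸) {α₀ : ℝ} (hα : 0 < α₀)
    (hα3 : C0Z d * (α₀ * (L : ℝ) ^ 2) ≤ 1 / 3) (hα2 : 2 * (α₀ * (L : ℝ) ^ 2) ≤ c2' d L)
    {η : ℝ} (hη : 0 < η) (hA : InAk L c.k η α₀ Ω U₀)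
    (hsmall : 11 * (d : ℝ) ^ 2 * (L : ℝ) ^ 2 * α₀ + ((c.M : ℝ) + 4 * c.ρ) * d * (L : ℝ) ^ 2 * α₀ ≤ 1 / 6)
    -- the pre-composition `h`: unitary, constant `= X(j, y)` on the block tower under every dented cell, oscillation `ω`
    (h : Site d → 𝔸ˣ) (hh : ∀ x, h x ∈ unitaryUnits 𝔸) (X : ℕ → Site d → 𝔸ˣ)
    (hconst : ∀ j, 1 ≤ j → j ≤ c.k → ∀ y ∈ c.lamS j, ∀ x, UnderZ L j y x → h x = X j y)
    {ω : ℝ} (hω : 0 ≤ ω)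
    (hoscj : ∀ j, j ≤ c.k → ∀ (z : Site d) (μ : Fin d),
      (∀ x, InBox (fun i => (L : ℤ) ^ j * z i - (ctrShift L j : ℤ)) (fun i => (L : ℤ) ^ j * z i + (ctrShift L j : ℤ) + if i = μ then (L : ℤ) ^ j else 0) x →
        x ∈ c.sq (j - 1)) → ‖((uLev L h j z : 𝔸ˣ) : 𝔸) - ((uLev L h j (z + e μ) : 𝔸ˣ) : 𝔸)‖ ≤ ω)
    (hosc0 : ∀ b ∈ {b : Site d × Fin d | SideTouches (c.sq 0) b.1 b.2}, ‖((h b.1 : 𝔸ˣ) : 𝔸) - ((h (b.1 + e b.2) : 𝔸ˣ) : 𝔸)‖ ≤ ω)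
    {α₂ : ℝ} (hα₂ : 0 ≤ α₂) (hα3' : C0Z d * ((L : ℝ) ^ 2 * ((L : ℝ) ^ 3 * α₀)) ≤ 1 / 3) (hα4' : 4 * ((L : ℝ) ^ 2 * ((L : ℝ) ^ 3 * α₀)) ≤ c2' d L)
    (h16 : 16 * α₂ ≤ 1)
    (hsm : Real.exp (4 * cZ d * ((L : ℝ) ^ 2 * ((L : ℝ) ^ 3 * α₀)))
      * (1 + 2 * (131072 * ((d : ℝ) + 1) ^ 2) * (KZ d L) ^ 2 * ((L : ℝ) * α₂)) ≤ 2)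
    (hc₃ : KZ d L * ((L : ℝ) * α₂) ≤ c3 d L) (hsmall₁ : (d : ℝ) * L * (6 * d * (L : ℝ) ^ 2 * c.M * α₀ + ω) ≤ 1 / 8)
    (u : Site d → 𝔸ˣ) (hu : ∀ x, u x ∈ unitaryUnits 𝔸)
    (h129 : Restr129Z L c.k (c.lamS) (1 : Site d → Fin d → 𝔸ˣ) u)
    (h162 : ∀ j, j ≤ c.k → ∀ b ∈ {b : Site d × Fin d | SideTouches (c.sq j) b.1 b.2},
      gaugeAct u⁻¹ (gaugeAct h (cutFixedZ L (tLo c.a c.ρ) (tHi c.a c.M c.ρ) U₀ c.k (ctr c.a c.M))) b.1 b.2 =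
          cfgExp η (logCfg η (gaugeAct u⁻¹ (gaugeAct h (cutFixedZ L (tLo c.a c.ρ) (tHi c.a c.M c.ρ) U₀ c.k (ctr c.a c.M))))) b.1 b.2 ∧
        IsSelfAdjoint (logCfg η (gaugeAct u⁻¹ (gaugeAct h (cutFixedZ L (tLo c.a c.ρ) (tHi c.a c.M c.ρ) U₀ c.k (ctr c.a c.M)))) b.1 b.2) ∧
        ‖logCfg η (gaugeAct u⁻¹ (gaugeAct h (cutFixedZ L (tLo c.a c.ρ) (tHi c.a c.M c.ρ) U₀ c.k (ctr c.a c.M)))) b.1 b.2‖ ≤ α₂ * ((L : ℝ) ^ j * η)⁻¹) :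
    ∀ j, j ≤ c.k → ∀ b ∈ c.lamBPT c.k j,
      ‖logCovIterZ L (1 : Site d → Fin d → 𝔸ˣ)
          (iEta η (mlogCfg c.k η c.sq (gaugeAct u⁻¹ (gaugeAct h (cutFixedZ L (tLo c.a c.ρ) (tHi c.a c.M c.ρ) U₀ c.k (ctr c.a c.M))))))
          j b.1 b.2‖ < 2 * d * L * (6 * d * (L : ℝ) ^ 2 * c.M * α₀ + ω) := by
  have hL : Odd L := ⟨s, by omega⟩
  have hL1 : 1 ≤ L := by omega
  have hd1 : 1 ≤ d := le_trans (by norm_num) hd2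
  have hk : 1 ≤ c.k := c.one_le_k
  have hρ : 1 ≤ c.ρ := hL1.trans c.L_le_ρ
  have hM1 : 1 ≤ c.M := hρ.trans c.ρ_le_M
  have hLpos : (0 : ℝ) < L := by exact_mod_cast hL1
  have hdpos : (0 : ℝ) < d := by exact_mod_cast hd1
  have hMpos : (0 : ℝ) < c.M := by exact_mod_cast hM1
  have hα₀' : 0 < (L : ℝ) ^ 3 * α₀ := by positivity
  have hα₁' : 0 < 6 * d * (L : ℝ) ^ 2 * c.M * α₀ + ω := by positivity
  set U'' := gaugeAct h (cutFixedZ L (tLo c.a c.ρ) (tHi c.a c.M c.ρ) U₀ c.k (ctr c.a c.M)) with hU''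
  obtain ⟨hmem, h33, h34, hAx, h135, -⟩ :=
    thm4_hypotheses_one_precomposed_dented_γ hLs hs hd1 c U₀ hU₀ hα hα3 hα2 hη hA hsmall h hh X hconst hoscj hosc0
  have hU₁u : ∀ x κ, gaugeAct u⁻¹ U'' x κ ∈ unitaryUnits 𝔸 :=
    gaugeAct_mem_of hmem fun x => (unitaryUnits 𝔸).inv_mem (hu x)
  -- the canonical exponent: Hermitian, `= (1/iη) log U₁` on the `E j`, `U₁ = e^{iηA}` there, `0` off them
  obtain ⟨hsa, hrep, hzero⟩ := mlogCfg_spec hη hL1 c.k (1 : Site d → Fin d → 𝔸ˣ) hU₁u hα₂ h16 c.sq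
    (fun j hj y τ hs => ⟨(h162 j hj (y, τ) hs).1, (h162 j hj (y, τ) hs).2.2⟩)
  have hWA : ∀ j, j ≤ c.k → ∀ y τ, SideTouches (c.sq j) y τ →
      gaugeAct u⁻¹ U'' y τ = cfgExp η (mlogCfg c.k η c.sq (gaugeAct u⁻¹ U'')) y τ ∧
        ‖mlogCfg c.k η c.sq (gaugeAct u⁻¹ U'') y τ‖ ≤ α₂ * ((L : ℝ) ^ j * η)⁻¹ := fun j hj y τ hs =>
    ⟨(hrep j hj y τ hs).2, by rw [(hrep j hj y τ hs).1]; exact (h162 j hj (y, τ) hs).2.2⟩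
  -- `U₁^{u} = U₀″`
  have hgU : mgauge (1 : Site d → Fin d → 𝔸ˣ) u (gaugeAct u⁻¹ U'') = U'' := by
    rw [mgauge_one_left, ← gaugeAct_mul, mul_inv_cancel, gaugeAct_one]
  have hT : c.lamST c.k = c.lamS := funext fun j => lamST_top_apply c j
  have h129' : Restr129Z L c.k (c.lamST c.k) (1 : Site d → Fin d → 𝔸ˣ) u := by rw [hT]; exact h129
  have hone : ∀ x κ, (1 : Site d → Fin d → 𝔸ˣ) x κ ∈ unitaryUnits 𝔸 := fun _ _ => (unitaryUnits 𝔸).one_mem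
  exact H42_of_inAx_γ hd2 hη hLs hs c.k hone hα₀' hα₁' hα₂ hα3' hα4' hsm hc₃ hsmall₁ c.sq
    (hΩ_sq c hL) c.lamST c.lamBPT (lamBPT_hbox_pred c hLs) (lamBPT_hclass c hLs)
    h33 h34 hAx h135 (fun _ _ => True) c.k hk le_rfl u (gaugeAct u⁻¹ U'') _ hu hgU h129' trivial hsa hWA hzero

#print axioms c137_dentedMember_precomposed_γ

end KLevel

end Literature.MathematicalPhysics.QuantumFieldTheory.Balaban1983to89.B8Prop6DentedCubeMemberNormsGammaPrecompRec

end
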